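import Summits.BirchSwinnertonDyer.BirchSwinnertonDyer.Theorems.EisensteinPrimesBSDpOnCellCTelescopeK2MemberControlModOfTransport
import Summits.BirchSwinnertonDyer.BirchSwinnertonDyer.Theorems.EisensteinPrimesBSDpOnCellCTelescopeK2MemberControlMapEventually
import Summits.BirchSwinnertonDyer.BirchSwinnertonDyer.Theorems.EisensteinPrimesBSDpOnCellCTelescopeK2MemberControlOfModNp
import Literature.NumberTheory.EllipticCurves.CaiShuTian2014.HeegnerConditionProofs
import HarnessLib

/-!
# Crux 4 `BSDpOnCellC` (stmt-BirchSwinnertonDyer-19034), line «telescope» v12 — THE REGISTERED LEAF N3″ `stub_memberControlModCofinite`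
# (member control OFF A FINITE EXCEPTIONAL SET OF FIBRE POINTS), BY NAME, from N1's fibre data, (fg), the Cell-C road prefix and the tree
# (`--supports stmt-BirchSwinnertonDyer-19034`; THEOREMS ONLY)

Cell `bsd-eis`, width seat `bsd-line-x2-p2` (prover g22, 2026-08-30; D-0154 KEY row 5). THEOREMS ONLY (no definition, no named fact, no instance,
no notation, no `sorry`). HONEST FRAMING: this file proves the text of the LEAD g4's telescope-v12 leaf N3″ `stub_memberControlModCofinite`
(`Cruxes/BSDpOnCellC/Lines/telescope.lean` v12) TOKEN FOR TOKEN — an implication between binder-only statements about a big Galois representation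
`ρ₂` carrying N1's fibre data; it does NOT prove N1 (the branch lattice), N2|pub, the crux, or any summit statement; BSD is proved for no curve.

THE STATEMENT (N3″). Under the Cell-C road prefix, for every `ρ₂` on a discrete `ℤ_p⟦X⟧`-module `A₂` with the fibre data FD⁺ ((tor), (cof₀),
(cof_k), (unr′), (fd₀), (rat_k)+(fd_k)) and (fg) `X₂ = XBig κ ρ₂ 𝔭̄ ∅` finitely generated over `B = ℤ_p⟦X⟧⟦T⟧`: there is a FINITE set `bad ⊂ ℤ_p` of
fibre points such that for every member `k` with `x_k ∉ bad`: (A) if `𝔛(g_k) = XBig κ (A_{g_k}^†|_{Γ_K}) 𝔭̄ ∅` is `Λ_{𝒪_k}`-torsion (every admissible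
topology) then a non-zero `t ∈ ℤ_p⟦T⟧` kills `X₂/π_k X₂`; (ctrl_k) for every `b : 𝒪_k → 𝓞_{ℂ_p}` over `ℚ̄_p → ℂ_p` and every admissible topology,
`C(p^j) · Ch(𝔛(g_k))^b ⊆ char_Λ(X₂/π_k X₂)^{toCpInt}` for some `j`.

THE PROOF (assembly over landed files, by name):
* the member control map `α_k : X₂/π_k X₂ → Sel_{𝔭̄,∅}(K, M₂[π_k])^∨` with kernel killed by `C((p : ℤ_p⟦X⟧)^m)` and finite cokernel exists for
  every `k` in the TRANSVERSAL `𝒦 = {k | ∀ j < k, x_j ≠ x_k}` of `x` outside a finite set (x2-p2 g21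
  `TelescopeK2MemberControlMapEventually.finite_setOf_not_memberControl_of_cellC`, p761336: Cell C + IQ + `p` split + `κ` anticyclotomic + (tor),
  (cof_k), (unr), (fd₀) + `x` injective on `𝒦`); `bad :=` the image under `x` of that finite set — the control statement depends on `k` only through
  `x_k`, and every `x_k` is `x_{k₀}` for some `k₀ ∈ 𝒦`;
* per member: this seat's `TelescopeK2MemberControlModOfTransport.memberControlMod_of_transport` (the member transport along (fd_k) over the
  bijective `ℤ_p → 𝒪_k` of (rat_k), `TelescopeK2MemberTransportCore.memberTransport`; finite generation of `𝔛(g_k)` by Skinner–Urban Lemma 3.1.9 for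
  the self-dual member representation, unramified outside the finite set `S = {w ∣ N}` — `N/p ∣ N` because `p ‖ N` at a multiplicative prime
  (`factorization_conductorNorm_eq_one_of_hasMultiplicativeReductionAtPrime`); the off-torsion vacuity).

References: R. Greenberg, LNM 1716 (1999) §4 [GreenbergLNM1716]; C. Skinner–E. Urban, Invent. Math. 195 (2014) Lemma 3.1.9, §3.1.6 [SkinnerUrban2014];
F. Castella, Camb. J. Math. 6 (2018) §2 and Erratum Lemma 2.1 [Castella2018Erratum]; J. Silverman, ATAEC IV.10.2 (b) [Silverman1994].
-/

set_option autoImplicit false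
set_option linter.dupNamespace false

noncomputable section

open scoped Classical MatrixGroups ModularForm

open CongruenceSubgroup WeierstrassCurve NumberField IsDedekindDomain Field PowerSeries
  Literature.NumberTheory.EllipticCurves Literature.NumberTheory.EllipticCurves.GreenbergSelmer
  Literature.NumberTheory.EllipticCurves.ModularForms Literature.NumberTheory.QuadraticFields
  Literature.NumberTheory.EllipticCurves.Rank1Residual
  Literature.NumberTheory.EllipticCurves.Rank1Residual.Typed
  Literature.NumberTheory.EllipticCurves.KrizLi2019
  Literature.NumberTheory.EllipticCurves.GreenbergVatsal2000
  Literature.NumberTheory.EllipticCurves.Wuthrich2014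
  Literature.NumberTheory.EllipticCurves.SteinWuthrich2013
  Literature.NumberTheory.EllipticCurves.Castella2018Exceptional
  Literature.NumberTheory.GaloisRepresentations Literature.NumberTheory.GaloisCohomology
  Literature.NumberTheory.Automorphic
  Summit.BirchSwinnertonDyer.Rank1Residual.X11b.AcSelmer
  Summit.BirchSwinnertonDyer.Rank1Residual.X11b.Halves
  Summit.BirchSwinnertonDyer.Rank1Residual.X11b
  Summit.BirchSwinnertonDyer.Rank1Residual Summit.BirchSwinnertonDyer.Rank1Residual.X1
  Summit.BirchSwinnertonDyer.Rank1Residual.X2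
open Literature.NumberTheory.EllipticCurves.KellerYin2024 (curveLocalLambda)

open Literature.NumberTheory.EllipticCurves.BigGaloisRep

namespace Summit.BirchSwinnertonDyer.BirchSwinnertonDyer.Theorems.TelescopeMemberControlModCofinite

open Literature.NumberTheory.EllipticCurves.CastellaGrossiLeeSkinner2022 Literature.NumberTheory.EllipticCurves.Castella2018
  Literature.NumberTheory.IwasawaTheory Literature.NumberTheory.IwasawaTheory.Greenberg2016
  Literature.NumberTheory.IwasawaTheory.Greenberg2006
  Summit.BirchSwinnertonDyer.Rank1Residual.X1.KellerYinMuLambdaSplit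
open Literature.NumberTheory.EllipticCurves.KellerYin2024
open Summit.BirchSwinnertonDyer.BirchSwinnertonDyer.Theorems

set_option maxHeartbeats 1600000 in
/-- **Leaf N3″ `stub_memberControlModCofinite` of telescope v12 (member control off a finite exceptional set of fibre points), BY NAME** — the
registered text TOKEN FOR TOKEN. Proof: the transversal of `x`, x2-p2 g21's member control map for all but finitely many members of an
`x`-injective index set (p761336), and this seat's per-member assembly `TelescopeK2MemberControlModOfTransport.memberControlMod_of_transport`
(member transport along (fd_k), Skinner–Urban Lemma 3.1.9 for the self-dual member representation, off-torsion vacuity); see the module docstring.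
[cite: GreenbergLNM1716, §4] [cite: SkinnerUrban2014, Lemma 3.1.9, §3.1.6] [cite: Castella2018Erratum, Lemma 2.1 (p. 2)] [cite: Silverman1994, IV.10.2 (b)] -/
theorem stub_memberControlModCofinite :
    ∀ (W : WeierstrassCurve ℚ) [W.IsElliptic] [W.IsGloballyMinimal] (p : ℕ) [Fact p.Prime],
    ∀ (N : ℕ) [NeZero N] (K : Type) [Field K] [NumberField K] (Dt : ModularParametrizationData W N)
      (H : HeegnerDatum N (NumberField.discr K)) (ιK : K →+* ℂ) (P : (W.baseChange K).toAffine.Point),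
      CellC W p → W.conductorNorm ℤ = N →
      IsImaginaryQuadratic K → NumberField.discr K < -4 → SatisfiesHeegnerHypothesis N K →
      (W.quadraticTwist (NumberField.discr K : ℚ)).entireLFunction 1 ≠ 0 →
      WeierstrassCurve.Affine.Point.map ιK.toRatAlgHom P = heegnerPointComplex Dt H →
      ¬ (p : ℤ) ∣ Dt.c → ¬ IsOfFinAddOrder P →
      Odd (NumberField.discr K) →
      ∀ (κ : ZpExtension K p), κ.IsAnticyclotomic →
        ∀ (γ : Field.absoluteGaloisGroup K) [Fact (κ.IsTopGenerator γ)]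
          (𝔭 : HeightOneSpectrum (𝓞 K)), ((p : ℕ) : 𝓞 K) ∈ 𝔭.asIdeal →
          𝔭.asIdeal.ramificationIdx (𝓞 ℚ) = 1 → 𝔭.asIdeal.inertiaDeg (𝓞 ℚ) = 1 →
          ∀ (𝔭bar : HeightOneSpectrum (𝓞 K)), ((p : ℕ) : 𝓞 K) ∈ 𝔭bar.asIdeal → 𝔭bar ≠ 𝔭 →
            ((Ideal.span {(p : ℤ)}).primesOver (𝓞 K)).ncard = 2 →
          ∀ (f : CuspForm (CongruenceSubgroup.Gamma0 N) 2), IsNewformOf W f →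
            ∀ (ι' : PadicAlgCl p ≃+* ℂ),
              (∀ (w : InfinitePlace K) (k : 𝓞 K),
                k ∈ 𝔭.asIdeal ↔ ‖ι'.symm (w.embedding (k : K))‖ < 1) →
              ∀ (ΩK : ℂ) (Ωp : ℂ_[p]) (Q : PowerSeries 𝓞_ℂ_[p]), ΩK ≠ 0 → ‖Ωp‖ = 1 →
                R1.IsBDPLFunctionInt p ι' 𝔭 κ γ f ΩK Ωp Q →
      ∀ (L : PowerSeries (PowerSeries (unrIntegers p))) (x : ℕ → ℤ_[p]) (D : ℕ → Skinner2016.HidaCongruentForm W p 1),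
        (∀ k, ‖x k‖ < 1) ∧ Filter.Tendsto x Filter.atTop (nhds 0) ∧
        (∃ e : ℕ, PowerSeries.C ((p : 𝓞_ℂ_[p]) ^ e) * Q ∈
          Ideal.span {PowerSeries.map (R1.unrToCpInt p) (PowerSeries.map (PowerSeries.constantCoeff (R := unrIntegers p)) L)}) ∧
        (∀ k : ℕ, (∀ y : coeffField (D k).g, ι' ((D k).ι y) = (y : ℂ)) ∧ 2 * ((p : ℤ) - 1) ∣ (D k).k - 2 ∧
          ∃ (ΩKg : ℂ) (Ωpg : ℂ_[p]) (Lg : UnrSeries p), ΩKg ≠ 0 ∧ ‖Ωpg‖ = 1 ∧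
            IsBDPLFunctionWt ι' 𝔭 κ γ (D k).g ΩKg Ωpg Lg ∧
          ∃ Ψ : UnrSeries p,
            (∃ U : PowerSeries (PowerSeries (unrIntegers p)),
              PowerSeries.map (PowerSeries.C (R := unrIntegers p)) Ψ =
                L + PowerSeries.C (PowerSeries.X - PowerSeries.C (toUnr p (x k))) * U) ∧
            (∃ e : ℕ, PowerSeries.C ((p : 𝓞_ℂ_[p]) ^ e) * PowerSeries.map (R1.unrToCpInt p) Ψ ∈
              Ideal.span {PowerSeries.map (R1.unrToCpInt p) Lg})) ∧
        (∃ A : ℕ → UnrSeries p, ∀ ℓ : ℕ, ℓ.Prime → ¬ ℓ ∣ N →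
          (∃ U : UnrSeries p, A ℓ = PowerSeries.C (toUnr p ((W.frobeniusTrace ℓ : ℤ) : ℤ_[p])) + PowerSeries.X * U) ∧
          ∀ k : ℕ, ∃ (c : unrIntegers p) (U : UnrSeries p),
            A ℓ = PowerSeries.C c + (PowerSeries.X - PowerSeries.C (toUnr p (x k))) * U ∧
            ((c : ℂ_[p]) = algebraMap (PadicAlgCl p) ℂ_[p]
              ((D k).ι ⟨(UpperHalfPlane.qExpansion 1 ⇑(D k).g).coeff ℓ, coeff_mem_coeffField (D k).g ℓ⟩))) →
      ∀ [TopologicalSpace (PowerSeries ℤ_[p])] (A₂ : Type) [AddCommGroup A₂]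
        [Module (PowerSeries ℤ_[p]) A₂] [TopologicalSpace A₂] [DiscreteTopology A₂]
        (ρ₂ : ContinuousRep (Field.absoluteGaloisGroup K) (PowerSeries ℤ_[p]) A₂)
        [TopologicalSpace (PowerSeries (PowerSeries ℤ_[p]))]
        [ContinuousSMul (PowerSeries (PowerSeries ℤ_[p])) (BigRepModule (PowerSeries ℤ_[p]) p A₂)]
        [Module (PowerSeries ℤ_[p]) (XBig κ ρ₂ 𝔭bar (∅ : Set (HeightOneSpectrum (𝓞 K))))]
        [IsScalarTower (PowerSeries ℤ_[p]) (PowerSeries (PowerSeries ℤ_[p]))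
          (XBig κ ρ₂ 𝔭bar (∅ : Set (HeightOneSpectrum (𝓞 K))))],
        ((∀ a : A₂, ∃ n : ℕ, (PowerSeries.X : PowerSeries ℤ_[p]) ^ n • a = 0) ∧
          (∀ a : A₂, ∃ b : A₂, (PowerSeries.X : PowerSeries ℤ_[p]) • b = a) ∧
          (∀ (k : ℕ) (a : A₂), ∃ b : A₂, (PowerSeries.X - PowerSeries.C (x k)) • b = a) ∧
          (∃ S₀ : Set (HeightOneSpectrum (𝓞 K)), S₀.Finite ∧ GaloisRep.IsUnramifiedOutside S₀ ρ₂ ∧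
            ∀ w ∈ S₀, ((p : ℕ) : 𝓞 K) ∉ w.asIdeal → ((N : ℕ) : 𝓞 K) ∈ w.asIdeal) ∧
          (∃ θ₀ : Submodule.torsionBy (PowerSeries ℤ_[p]) A₂ (PowerSeries.X : PowerSeries ℤ_[p]) →+
              PrimaryTorsion (W.baseChange K).geomPoints p,
            (∀ (c : ℤ_[p]) (a : Submodule.torsionBy (PowerSeries ℤ_[p]) A₂ (PowerSeries.X : PowerSeries ℤ_[p])),
                θ₀ (PowerSeries.C c • a) = c • θ₀ a) ∧
            (∀ (σ : Field.absoluteGaloisGroup K)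
                (a : Submodule.torsionBy (PowerSeries ℤ_[p]) A₂ (PowerSeries.X : PowerSeries ℤ_[p])),
                θ₀ (BigGaloisRep.torsionRep ρ₂ (PowerSeries.X : PowerSeries ℤ_[p]) σ a) =
                  (W.baseChange K).primaryTorsionGaloisRep p σ (θ₀ a)) ∧
            Finite θ₀.ker ∧ Finite (PrimaryTorsion (W.baseChange K).geomPoints p ⧸ θ₀.range)) ∧
          (∀ k : ℕ, Function.Surjective (algebraMap ℤ_[p] (padicCoeffIntegers (D k).ι)) ∧
            ∃ θ : Submodule.torsionBy (PowerSeries ℤ_[p]) A₂ (PowerSeries.X - PowerSeries.C (x k)) →+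
                Cofree (D k).Δ.selfDualRep (padicCoeffField (D k).ι),
              (∀ (c : ℤ_[p])
                  (a : Submodule.torsionBy (PowerSeries ℤ_[p]) A₂ (PowerSeries.X - PowerSeries.C (x k))),
                  θ (PowerSeries.C c • a) = algebraMap ℤ_[p] (padicCoeffIntegers (D k).ι) c • θ a) ∧
              (∀ (σ : Field.absoluteGaloisGroup K)
                  (a : Submodule.torsionBy (PowerSeries ℤ_[p]) A₂ (PowerSeries.X - PowerSeries.C (x k))),
                  θ (BigGaloisRep.torsionRep ρ₂ (PowerSeries.X - PowerSeries.C (x k)) σ a) =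
                    (D k).Δ.selfDualCofreeRepOver K σ (θ a)) ∧
              Finite θ.ker ∧ Finite (Cofree (D k).Δ.selfDualRep (padicCoeffField (D k).ι) ⧸ θ.range))) →
        Module.Finite (PowerSeries (PowerSeries ℤ_[p])) (XBig κ ρ₂ 𝔭bar (∅ : Set (HeightOneSpectrum (𝓞 K)))) →
        ∃ bad : Set ℤ_[p], bad.Finite ∧ ∀ k : ℕ, x k ∉ bad →
          ((∀ [TopologicalSpace (PowerSeries (padicCoeffIntegers (D k).ι))]
              [ContinuousSMul (PowerSeries (padicCoeffIntegers (D k).ι))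
                (BigRepModule (padicCoeffIntegers (D k).ι) p (Cofree (D k).Δ.selfDualRep (padicCoeffField (D k).ι)))],
              Module.IsTorsion (PowerSeries (padicCoeffIntegers (D k).ι))
                (XBig κ ((D k).Δ.selfDualCofreeRepOver K) 𝔭bar (∅ : Set (HeightOneSpectrum (𝓞 K))))) →
            ∃ t : PowerSeries ℤ_[p], t ≠ 0 ∧
              ∀ m : QuotSMulTop (PowerSeries.C (PowerSeries.X - PowerSeries.C (x k)))
                (XBig κ ρ₂ 𝔭bar (∅ : Set (HeightOneSpectrum (𝓞 K)))), t • m = 0) ∧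
          ∀ (b : padicCoeffIntegers (D k).ι →+* 𝓞_ℂ_[p]),
            (∀ y, ((b y : 𝓞_ℂ_[p]) : ℂ_[p]) =
              algebraMap (PadicAlgCl p) ℂ_[p] (padicCoeffIntegers.toPadicAlgCl (D k).ι y)) →
          ∀ [TopologicalSpace (PowerSeries (padicCoeffIntegers (D k).ι))]
            [ContinuousSMul (PowerSeries (padicCoeffIntegers (D k).ι))
              (BigRepModule (padicCoeffIntegers (D k).ι) p (Cofree (D k).Δ.selfDualRep (padicCoeffField (D k).ι)))],
            ∃ j : ℕ, Ideal.span {PowerSeries.C ((p : 𝓞_ℂ_[p]) ^ j)} *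
                (XBig.charIdeal κ ((D k).Δ.selfDualCofreeRepOver K) 𝔭bar
                  (∅ : Set (HeightOneSpectrum (𝓞 K)))).map (PowerSeries.map b) ≤
              (Literature.NumberTheory.EllipticCurves.Module.charIdeal (PowerSeries ℤ_[p])
                  (QuotSMulTop (PowerSeries.C (PowerSeries.X - PowerSeries.C (x k)))
                    (XBig κ ρ₂ 𝔭bar (∅ : Set (HeightOneSpectrum (𝓞 K)))))).map
                (PowerSeries.map (R1.toCpInt p)) := by
  intro W _ _ p _ N _ K _ _ Dt H ιK P hC hN hK hdisc hHeeg hL1 hP hc hfin hodd κ hκ γ _ 𝔭 h𝔭 hram hdeg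
    𝔭bar h𝔭bar hne hsp f hf ι' hι' ΩK Ωp Q hΩK hΩp hQ L x D hpkg τ A₂ _ _ _ _ ρ₂ _ _ _ _ hFD hfg
  obtain ⟨hx, -, -, -, -⟩ := hpkg
  obtain ⟨htor, -, hcof, ⟨S₀, hS₀, hunr, -⟩, ⟨θ₀, hθ₀C, hθ₀G, hker₀, -⟩, hfdk⟩ := hFD
  -- the finite set `S` of places dividing `N`; the members' level `N/p` divides `N` (`p ‖ N` at the multiplicative prime `p`)
  have hp : p.Prime := Fact.out
  have hN0 : W.conductorNorm ℤ ≠ 0 := (W.conductorNorm_pos_holds).ne'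
  have hpN : p ∣ W.conductorNorm ℤ :=
    (hp.dvd_iff_one_le_factorization hN0).mpr
      (W.factorization_conductorNorm_eq_one_of_hasMultiplicativeReductionAtPrime p hC.2.2.2).ge
  have hNK0 : ((N : ℕ) : 𝓞 K) ≠ 0 := by exact_mod_cast (NeZero.ne N)
  set S : Set (HeightOneSpectrum (𝓞 K)) := {w | ((N : ℕ) : 𝓞 K) ∈ w.asIdeal} with hSdef
  have hS : S.Finite := by
    refine (Ideal.finite_factors (I := Ideal.span {((N : ℕ) : 𝓞 K)}) ?_).subset ?_
    · rw [Ne, Ideal.zero_eq_bot, Ideal.span_singleton_eq_bot]; exact hNK0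
    · intro w hw; exact (Ideal.dvd_span_singleton).mpr hw
  have hSM : ∀ w : HeightOneSpectrum (𝓞 K), w ∉ S → ((W.conductorNorm ℤ / p : ℕ) : 𝓞 K) ∉ w.asIdeal := by
    intro w hw hMw
    apply hw
    change ((N : ℕ) : 𝓞 K) ∈ w.asIdeal
    rw [← hN, ← Nat.div_mul_cancel hpN, Nat.cast_mul]
    exact w.asIdeal.mul_mem_right _ hMw
  -- the transversal `𝒦` of `x`: first occurrences of each fibre point
  set 𝒦 : Set ℕ := {k | ∀ j < k, x j ≠ x k} with h𝒦def
  have hinj : Set.InjOn x 𝒦 := by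
    intro k₁ hk₁ k₂ hk₂ h
    by_contra hne12
    rcases lt_or_gt_of_ne hne12 with hlt | hlt
    · exact hk₂ k₁ hlt h
    · exact hk₁ k₂ hlt h.symm
  have hrep : ∀ k : ℕ, ∃ k₀ ∈ 𝒦, x k₀ = x k := fun k => by
    have hex : ∃ j, x j = x k := ⟨k, rfl⟩
    refine ⟨Nat.find hex, fun j hj hxj => Nat.find_min hex hj ?_, Nat.find_spec hex⟩
    rw [hxj]; exact Nat.find_spec hex
  -- the member control map exists off a finite subset of `𝒦` (x2-p2 g21, p761336)
  set P : ℤ_[p] → Prop := fun c =>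
    ∃ α : QuotSMulTop (PowerSeries.C (PowerSeries.X - PowerSeries.C c : PowerSeries ℤ_[p]))
          (XBig κ ρ₂ 𝔭bar (∅ : Set (HeightOneSpectrum (𝓞 K))))
        →ₗ[PowerSeries (PowerSeries ℤ_[p])]
        CharacterModule (TorsionControl.selmer (localMap K) (strictSet p 𝔭bar (∅ : Set (HeightOneSpectrum (𝓞 K))))
          (TorsionControl.torsionRep (AnticyclotomicBigGaloisRep κ ρ₂)
            (PowerSeries.C (PowerSeries.X - PowerSeries.C c : PowerSeries ℤ_[p])))),
      (∃ m : ℕ, ∀ v ∈ LinearMap.ker α, (PowerSeries.C ((p : PowerSeries ℤ_[p]) ^ m) : PowerSeries (PowerSeries ℤ_[p])) • v = 0) ∧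
      (∀ v ∈ LinearMap.ker α, ∃ s : PowerSeries (PowerSeries ℤ_[p]),
        ¬ ((PowerSeries.C (PowerSeries.X - PowerSeries.C c : PowerSeries ℤ_[p])) ∣ s) ∧ s • v = 0) ∧
      Finite ((CharacterModule (TorsionControl.selmer (localMap K) (strictSet p 𝔭bar (∅ : Set (HeightOneSpectrum (𝓞 K))))
        (TorsionControl.torsionRep (AnticyclotomicBigGaloisRep κ ρ₂)
          (PowerSeries.C (PowerSeries.X - PowerSeries.C c : PowerSeries ℤ_[p]))))) ⧸ LinearMap.range α) with hPdef
  have h8 : {k : ℕ | k ∈ 𝒦 ∧ ¬ P (x k)}.Finite :=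
    TelescopeK2MemberControlMapEventually.finite_setOf_not_memberControl_of_cellC W hC hK hsp κ hκ 𝔭bar h𝔭bar
      A₂ ρ₂ htor x hx 𝒦 hinj (fun k _ => hcof k) S₀ hS₀ hunr θ₀ hθ₀C hθ₀G hker₀
  refine ⟨x '' {k : ℕ | k ∈ 𝒦 ∧ ¬ P (x k)}, h8.image x, fun k hk => ?_⟩
  -- at a good fibre point the control map exists (through the representative in `𝒦`)
  have hPk : P (x k) := by
    by_contra hPk
    obtain ⟨k₀, hk₀, hxk₀⟩ := hrep k
    exact hk ⟨k₀, ⟨hk₀, by rw [hxk₀]; exact hPk⟩, hxk₀⟩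
  obtain ⟨α, ⟨m, hαker⟩, -, hαcoker⟩ := hPk
  obtain ⟨hrat, θ, hθC, hθG, hkerθ, hcokerθ⟩ := hfdk k
  exact TelescopeK2MemberControlModOfTransport.memberControlMod_of_transport κ 𝔭bar ρ₂ hfg (hx k) (D k).Δ hrat
    θ hθC hθG hkerθ hcokerθ S hS hSM α m hαker hαcoker

end Summit.BirchSwinnertonDyer.BirchSwinnertonDyer.Theorems.TelescopeMemberControlModCofinite

end
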